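import Summits.QuantumFields.BalabanUV.T4Continuum.Spine.NE1p.TiltedMeanSmoothDualTilt
import Summits.QuantumFields.BalabanUV.T4Continuum.Spine.NE1p.TiltedMeanSmoothDualCritical
import Summits.QuantumFields.BalabanUV.T4Continuum.Spine.NE7.QLaFromNE1p

/-!
# T⁴ programme, spine estimate NE1′ (node O3b/H2) — CRITICALITY ON THE TILT FAMILY: the per-slot influence on the TILTED MEAN under a
# nonlinear transfer carries the product of two flatness factors, and the first-order channel's ledger letter is `θ₁φΛ` (`= L⁻¹` in
# `d = 4`) next to the second order's `θ₁²Λ` (`= L⁻²`)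

Cell `pub-balaban-gaps` (YM blitz Y1, track G2), seat `ne1` gen 7 (prover-pub-balaban-gaps-ne1-g7-0), record `HOME/ne/NE1.md` §4 rows
R46–R48 (gen 7).  ADDITIVE — imports the seat's gen-6 `TiltedMeanSmoothDualTilt` (p353222 ✓: the tilt family's derivatives and
majorants, `fibredLaw`; through it `TiltedMeanSmoothDual` p352607 ✓ — the parent inequality `abs_tiltedMean_sub_le_of_tests` — and
gen 5's `exp_neg_abs_le_exp_mul`, `oldInfluenceBudget_of_visibility`, gen 3's `OldInfluenceBudget`), the sibling
`TiltedMeanSmoothDualCritical` (same generation: `abs_deriv_sub_le_of_deriv_two_bound`, `abs_fibred_swap_le_of_critical`,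
`abs_flat_displacement_le`) and ne7's `Spine.NE7.QLaFromNE1p` (the letter lemma `firstOrder_rate_lt_one_iff` BY NAME) ONLY; modifies
nothing.

WHAT THIS IS.  The sibling shows, for an abstract test function, that under a NONLINEAR transfer `Φ u v` of the slot to the unit field
the first-order channel of the fibred swap is (slope of the test function at the exterior's level) × (fibrewise mean-DISPLACEMENT
discrepancy), that a fibre law centred in the slot variable does NOT remove it (curvature × second-moment discrepancy survives,
attained), and that a test function CRITICAL at the flat level turns its own slope into a flatness factor.  This file closes the loop on
the binder's object:
* §1 THE TILT FAMILY INHERITS THE LOOP'S CRITICALITY: if `W'(x₀) = 0` (the loop at flat holonomy, `dW(1) = 0` — ne7's `ReTrCrit`) then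
  `(e^{sW})'(x₀) = 0` and `(W e^{sW})'(x₀) = 0` for EVERY tilt `s` (`expTilt_deriv_eq_zero`, `mulExpTilt_deriv_eq_zero`), and the two
  derivatives are Lipschitz with the SAME constants `G₂(s) = (|s|B₂ + s²B₁²)e^{|s|B}`, `F₂(s) = ((1 + |s|B)B₂ + |s|(2 + |s|B)B₁²)e^{|s|B}`
  that gen 6 found as Taylor majorants (`abs_expTilt_deriv_sub_le`, `abs_mulExpTilt_deriv_sub_le`) — criticality costs no new constant.
* §2 THE IMAGE LAW `imageLaw EU EV ν κ Φ = Σ_u Σ_v (ν u·κ u v)·δ_{Φ u v}` of a general transfer (gen 6's `fibredLaw` is the additive instance,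
  `fibredLaw_eq_imageLaw`, by `rfl`), its integrals, the swap difference, non-degeneracy.
* §3 **`abs_tiltedMean_image_sub_le_of_critical`** — THE PER-SLOT INFLUENCE ON THE TILTED MEAN WITH BOTH FLATNESS FACTORS: exterior
  weights `ν ≥ 0`, fibre kernels `κA` ∕ `κB` `≥ 0` depending arbitrarily on the exterior with equal fibre masses, unit field `Φ u v`
  ARBITRARY, `W` twice differentiable with `|W| ≤ B`, `|W'| ≤ B₁`, `|W''| ≤ B₂` and CRITICAL at the flat level `x₀ u` of every fibre:
  for EVERY tilt `s`,
  `|tiltedMean W (on) s − tiltedMean W (off) s| ≤ e^{2|s|B}·C₂(s)·(Σ_u ν_u·|m u − x₀ u|·|Σ_v (κB − κA)(Φ u v − m u)| + M₂) ∕ mass(on)`,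
  `C₂(s) = (1 + |s|B)B₂ + |s|(2 + |s|B)B₁² + B(|s|B₂ + s²B₁²)` — gen 6's SECOND-order constant now serves the first-order channel too
  (`B₁` no longer multiplies anything on its own), and the channel is (exterior's distance from the flat orbit) × (fibrewise
  mean-displacement discrepancy): NE1.md R28 (2)'s two factors on the binder's own object.  With the sibling's split of the displacement
  (`θ·ℓ v + r`, `|r| ≤ θ₂ q v`) and fibres centred in the linear image: `≤ e^{2|s|B}·C₂(s)·(θ₂·Σ_u ν_u |m u − x₀ u|·Q_u + M₂) ∕ mass`
  (`abs_tiltedMean_image_sub_le_of_centred_of_critical`) — the curvature of the averaging enters at first order × exterior flatness.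
* §4 THE LEDGER WITH TWO PROFILES (`oldInfluenceBudget_of_flatness_profile`): per-slot bounds
  `Cv·(θ₁^{K − sc X}·F X + θ₁^{2(K − sc X)}·M X)` — first order × a flatness profile `F X ≤ σF·φ^{K − sc X}` ([B12] (1.11)∕(1.14), [B14]
  (2.34) KIND: backgrounds in the scale-`j` inductive domains are flat to `φ^{K−j}`, `φ = L⁻²`, NE1.md R28 (β2) — a READING, the
  hypothesis here) + second order × `M X ≤ σM` —, at most `vol·Λ^{K−j}` scale-`j` slots ⇒ `OldInfluenceBudget l₀ T Bad wf sc Δ vol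
  (Cv·(σF + σM)) r` for any `r ≥ max(θ₁φΛ, θ₁²Λ)`; in `d = 4` (`θ₁ = L⁻³`, `φ = L⁻²`, `Λ = L⁴`) the two letters are `L⁻¹` and `L⁻²`
  (`flatFirstOrder_rate_eq`, `flatFirstOrder_rate_lt_one` via ne7's `firstOrder_rate_lt_one_iff`; `Spine.NE7.rate_secondOrder_lt_one`),
  so the budget's letter is `a = L⁻¹` — R28 (2)'s «a = L⁴θ₁φ = L⁻¹ < 1» as a theorem of the ledger, next to gen 4∕6's `θ₁²Λ = L⁻²` for
  the centred∕critical-at-flat part.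
CONSEQUENCE FOR THE ROW (NE1.md v7 §0 l.13, R46–R48).  The smooth-dual currency's per-slot producer inputs after gen 7: transfer rates
`θ₁^{K−j}` of gradient AND curvature of the composed averaging; the fibrewise mean-DISPLACEMENT discrepancy (zero at flat exteriors by
conjugation symmetry — to all orders in the nonlinearity —, of size `φ^{K−j}` off them: the flatness profile); criticality of the loop at
flat holonomy (kernel on ne7's side; it removes `B₁` from the first-order constant and contributes the exterior's unit-scale flatness);
`C²` of the loop (free).  NOT inputs: smoothness of any law, decoupling.  Old-slot budget letter in this currency: `max(θ₁φΛ, θ₁²Λ) =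
L⁻¹`.  Classification of NE1′ UNCHANGED: WORK-bound ∕ OBJECT-bound ∕ NOT idea-bound.

HONEST FRAMING.  [folklore] calculus and measure theory (chain rule, mean value inequality, Dirac masses, finite sums) over ABSTRACT
data; the image law is a MODEL of one slot (dependent, nonlinear transfer to ONE unit-field coordinate), NOT Bałaban's
class-conditioned law; the flatness profile `φ^{K−j}` and the sizes `θ₂ ≍ θ₁^{K−j}` are READINGS quoted for orientation, hypotheses
here, not certified;
nothing of his is asserted or instantiated; which slots have which rates, discrepancies and moments is row NE1′'s OBJECT-bound content
behind NODE O.  NE1′ NOT proved; spine 0∕9; (B) 0∕13; one fixed finite T⁴ — NOT ℝ⁴, NOT infinite volume, NOT a mass gap, NOT Clay.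
0 sorry.
-/

noncomputable section

open MeasureTheory ProbabilityTheory Finset
open scoped BigOperators NNReal ENNReal

namespace Summit.QuantumFields.BalabanUV.T4Continuum.NE1p.TiltedMeanSmoothDualCriticalTilt

open Summit.QuantumFields.BalabanUV.T4Continuum.NE1p.DressedMGFForm (tiltedMean)
open Summit.QuantumFields.BalabanUV.T4Continuum.NE1p.TiltedMeanVisibility (exp_neg_abs_le_exp_mul
  oldInfluenceBudget_of_visibility)
open Summit.QuantumFields.BalabanUV.T4Continuum.NE1p.TiltedMeanCrossover (OldInfluenceBudget)
open Summit.QuantumFields.BalabanUV.T4Continuum.NE1p.TiltedMeanSmoothDual (abs_tiltedMean_sub_le_of_tests)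
open Summit.QuantumFields.BalabanUV.T4Continuum.NE1p.TiltedMeanSmoothDualTilt (hasDerivAt_expTilt_deriv hasDerivAt_mulExpTilt_deriv
  abs_expTilt_deriv_two_le abs_mulExpTilt_deriv_two_le taylor_two_expTilt taylor_two_mulExpTilt fibredLaw)
open Summit.QuantumFields.BalabanUV.T4Continuum.NE1p.TiltedMeanSmoothDualCritical (abs_deriv_sub_le_of_deriv_two_bound
  abs_fibred_swap_le_of_critical abs_flat_displacement_le)
open Literature.MathematicalPhysics.QuantumFieldTheory.Balaban1983to89

/-! ## §1 The tilt family inherits the loop's criticality, with gen 6's constants -/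

section TiltFamily

variable {W W' W'' : ℝ → ℝ} {B B₁ B₂ : ℝ}

/-- `W'(x₀) = 0` ⇒ `(e^{sW})'(x₀) = 0` for every tilt `s`. [folklore] -/
theorem expTilt_deriv_eq_zero {x₀ : ℝ} (h0 : W' x₀ = 0) (s : ℝ) : s * W' x₀ * Real.exp (s * W x₀) = 0 := by
  rw [h0, mul_zero, zero_mul]

/-- `W'(x₀) = 0` ⇒ `(W·e^{sW})'(x₀) = 0` for every tilt `s`. [folklore] -/
theorem mulExpTilt_deriv_eq_zero {x₀ : ℝ} (h0 : W' x₀ = 0) (s : ℝ) : (1 + s * W x₀) * W' x₀ * Real.exp (s * W x₀) = 0 := by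
  rw [h0, mul_zero, zero_mul]

/-- The first derivative of `e^{sW}` is `G₂(s)`-Lipschitz, `G₂(s) = (|s|B₂ + s²B₁²)e^{|s|B}` — the same constant as its Taylor majorant
(gen 6 `taylor_two_expTilt`). [folklore] -/
theorem abs_expTilt_deriv_sub_le (hW : ∀ y, HasDerivAt W (W' y) y) (hW' : ∀ y, HasDerivAt W' (W'' y) y)
    (hWb : ∀ y, |W y| ≤ B) (hW'b : ∀ y, |W' y| ≤ B₁) (hW''b : ∀ y, |W'' y| ≤ B₂) (s x y : ℝ) :
    |s * W' x * Real.exp (s * W x) - s * W' y * Real.exp (s * W y)| ≤ (|s| * B₂ + s ^ 2 * B₁ ^ 2) * Real.exp (|s| * B) * |x - y| :=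
  abs_deriv_sub_le_of_deriv_two_bound (g' := fun y => s * W' y * Real.exp (s * W y)) (hasDerivAt_expTilt_deriv hW hW' s)
    (abs_expTilt_deriv_two_le hWb hW'b hW''b s) x y

/-- The first derivative of `W·e^{sW}` is `F₂(s)`-Lipschitz, `F₂(s) = ((1 + |s|B)B₂ + |s|(2 + |s|B)B₁²)e^{|s|B}`. [folklore] -/
theorem abs_mulExpTilt_deriv_sub_le (hW : ∀ y, HasDerivAt W (W' y) y) (hW' : ∀ y, HasDerivAt W' (W'' y) y)
    (hWb : ∀ y, |W y| ≤ B) (hW'b : ∀ y, |W' y| ≤ B₁) (hW''b : ∀ y, |W'' y| ≤ B₂) (s x y : ℝ) :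
    |(1 + s * W x) * W' x * Real.exp (s * W x) - (1 + s * W y) * W' y * Real.exp (s * W y)|
      ≤ ((1 + |s| * B) * B₂ + |s| * (2 + |s| * B) * B₁ ^ 2) * Real.exp (|s| * B) * |x - y| :=
  abs_deriv_sub_le_of_deriv_two_bound (g' := fun y => (1 + s * W y) * W' y * Real.exp (s * W y))
    (hasDerivAt_mulExpTilt_deriv hW hW' s) (abs_mulExpTilt_deriv_two_le hWb hW'b hW''b s) x y

end TiltFamily

/-! ## §2 The image law of a general (nonlinear) transfer, and its integrals -/

section Image

variable {U V : Type*}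

/-- The IMAGE LAW of the unit-field coordinate under a general transfer: exterior `u ∈ EU` with weight `ν u`, slot value `v ∈ EV` with
fibre weight `κ u v`, unit-field value `Φ u v` (ARBITRARY — the composed block averaging is nonlinear in the slot variable).  A finite
sum of weighted Dirac masses on `ℝ`; NO density.  Gen 6's `fibredLaw` is the additive instance `Φ u v = m u + θ·ℓ v`. -/
def imageLaw (EU : Finset U) (EV : Finset V) (ν : U → ℝ) (κ : U → V → ℝ) (Φ : U → V → ℝ) : Measure ℝ :=
  ∑ u ∈ EU, ∑ v ∈ EV, ENNReal.ofReal (ν u * κ u v) • Measure.dirac (Φ u v)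

variable {EU : Finset U} {EV : Finset V} {ν : U → ℝ} {κ κA κB : U → V → ℝ} {Φ : U → V → ℝ}

/-- Gen 6's fibred atomic law IS the image law of the additive transfer (definitionally). [folklore] -/
theorem fibredLaw_eq_imageLaw (m : U → ℝ) (ℓ : V → ℝ) (θ : ℝ) :
    fibredLaw EU EV ν κ m ℓ θ = imageLaw EU EV ν κ (fun u v => m u + θ * ℓ v) := rfl

/-- The image law is a finite measure. [folklore] -/
instance isFiniteMeasure_imageLaw : IsFiniteMeasure (imageLaw EU EV ν κ Φ) := by
  refine ⟨?_⟩
  simp only [imageLaw, Measure.coe_finsetSum, Measure.coe_smul, Finset.sum_apply, Pi.smul_apply, measure_univ,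
    smul_eq_mul, mul_one]
  exact ENNReal.sum_lt_top.mpr fun u _ => ENNReal.sum_lt_top.mpr fun v _ => ENNReal.ofReal_lt_top

/-- Integrals against the image law are the fibred finite sums (every `g : ℝ → ℝ`). [folklore] -/
theorem integral_imageLaw (g : ℝ → ℝ) (hν : ∀ u ∈ EU, 0 ≤ ν u) (hκ : ∀ u ∈ EU, ∀ v ∈ EV, 0 ≤ κ u v) :
    ∫ x, g x ∂(imageLaw EU EV ν κ Φ) = ∑ u ∈ EU, ν u * ∑ v ∈ EV, κ u v * g (Φ u v) := by
  have hi : ∀ a : ℝ, Integrable g (Measure.dirac a) := fun a => (integrable_const (g a)).congr (ae_eq_dirac g).symm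
  have hiv : ∀ u, ∀ v ∈ EV, Integrable g (ENNReal.ofReal (ν u * κ u v) • Measure.dirac (Φ u v)) :=
    fun u v _ => (hi _).smul_measure ENNReal.ofReal_ne_top
  unfold imageLaw
  rw [integral_finsetSum_measure fun u _ => integrable_finsetSum_measure.mpr (hiv u)]
  refine sum_congr rfl fun u hu => ?_
  rw [integral_finsetSum_measure (hiv u), mul_sum]
  refine sum_congr rfl fun v hv => ?_
  rw [integral_smul_measure, integral_dirac, ENNReal.toReal_ofReal (mul_nonneg (hν u hu) (hκ u hu v hv)), smul_eq_mul,
    mul_assoc]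

/-- The difference of the two image laws' integrals is the fibred swap sum of the sibling's §2. [folklore] -/
theorem integral_imageLaw_sub (g : ℝ → ℝ) (hν : ∀ u ∈ EU, 0 ≤ ν u) (hκA : ∀ u ∈ EU, ∀ v ∈ EV, 0 ≤ κA u v)
    (hκB : ∀ u ∈ EU, ∀ v ∈ EV, 0 ≤ κB u v) :
    (∫ x, g x ∂(imageLaw EU EV ν κB Φ)) - ∫ x, g x ∂(imageLaw EU EV ν κA Φ)
      = ∑ u ∈ EU, ν u * ∑ v ∈ EV, (κB u v - κA u v) * g (Φ u v) := by
  rw [integral_imageLaw g hν hκB, integral_imageLaw g hν hκA, ← sum_sub_distrib]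
  refine sum_congr rfl fun u _ => ?_
  rw [← mul_sub, ← sum_sub_distrib]
  congr 1
  refine sum_congr rfl fun v _ => ?_
  ring

/-- An image law of positive total weight is non-zero. [folklore] -/
theorem imageLaw_neZero (hν : ∀ u ∈ EU, 0 ≤ ν u) (hκ : ∀ u ∈ EU, ∀ v ∈ EV, 0 ≤ κ u v)
    (hpos : 0 < ∑ u ∈ EU, ν u * ∑ v ∈ EV, κ u v) : NeZero (imageLaw EU EV ν κ Φ) := by
  refine ⟨fun h0 => ?_⟩
  have h1 := integral_imageLaw (EU := EU) (EV := EV) (ν := ν) (κ := κ) (Φ := Φ) (fun _ => (1 : ℝ)) hν hκ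
  rw [h0, integral_zero_measure] at h1
  simp only [mul_one] at h1
  exact (lt_irrefl (0 : ℝ)) (h1 ▸ hpos)

end Image

/-! ## §3 The per-slot influence on the tilted mean under a nonlinear transfer: both flatness factors, gen 6's constant -/

section Influence

variable {U V : Type*} {EU : Finset U} {EV : Finset V} {ν : U → ℝ} {κA κB : U → V → ℝ} {Φ : U → V → ℝ} {m x₀ : U → ℝ}
  {W W' W'' : ℝ → ℝ} {B B₁ B₂ : ℝ}

/-- **THE PER-SLOT INFLUENCE ON THE TILTED MEAN — NONLINEAR TRANSFER, CRITICAL LOOP, BOTH FLATNESS FACTORS.**  Exterior weights `ν ≥ 0`,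
fibre kernels `κA` (off) ∕ `κB` (on) `≥ 0` depending arbitrarily on the exterior with equal fibre masses and positive total weight on,
unit field `Φ u v` arbitrary, reference levels `m u`, loop observable `W` with `|W| ≤ B`, `|W'| ≤ B₁`, `|W''| ≤ B₂` and
`W'(x₀ u) = 0` (critical at the flat level of each fibre).  For EVERY tilt `s`, with
`FlatC = Σ_u ν_u·|m u − x₀ u|·|Σ_v (κB − κA)(u,v)·(Φ u v − m u)|` (exterior flatness × fibrewise mean-displacement discrepancy) and
`M₂ = Σ_u ν_u Σ_v (κA + κB)(u,v)·(Φ u v − m u)²`: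
`|tiltedMean W (on) s − tiltedMean W (off) s| ≤ e^{2|s|B}·C₂(s)·(FlatC + M₂) ∕ Σ_u ν_u Σ_v κB(u,v)`,
`C₂(s) = (1 + |s|B)B₂ + |s|(2 + |s|B)B₁² + B(|s|B₂ + s²B₁²)` nondecreasing in `|s|`.  Inputs: the parent inequality (gen 6), §1, the
sibling's `abs_fibred_swap_le_of_critical`.  NOT used: smoothness or absolute continuity of the unit-field law (atomic), independence
of slot and exterior, any expansion, any bound on the slope of `W` outside `C₂`. [folklore] -/
theorem abs_tiltedMean_image_sub_le_of_critical (hν : ∀ u ∈ EU, 0 ≤ ν u) (hκA : ∀ u ∈ EU, ∀ v ∈ EV, 0 ≤ κA u v)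
    (hκB : ∀ u ∈ EU, ∀ v ∈ EV, 0 ≤ κB u v) (hmass : ∀ u ∈ EU, ∑ v ∈ EV, κA u v = ∑ v ∈ EV, κB u v)
    (hpos : 0 < ∑ u ∈ EU, ν u * ∑ v ∈ EV, κB u v)
    (hWm : Measurable W) (hW : ∀ y, HasDerivAt W (W' y) y) (hW' : ∀ y, HasDerivAt W' (W'' y) y)
    (hWb : ∀ y, |W y| ≤ B) (hW'b : ∀ y, |W' y| ≤ B₁) (hW''b : ∀ y, |W'' y| ≤ B₂) (hcrit : ∀ u ∈ EU, W' (x₀ u) = 0) (s : ℝ) :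
    |tiltedMean W (imageLaw EU EV ν κB Φ) s - tiltedMean W (imageLaw EU EV ν κA Φ) s|
      ≤ Real.exp (2 * (|s| * B)) * ((1 + |s| * B) * B₂ + |s| * (2 + |s| * B) * B₁ ^ 2 + B * (|s| * B₂ + s ^ 2 * B₁ ^ 2))
          * ((∑ u ∈ EU, ν u * (|m u - x₀ u| * |∑ v ∈ EV, (κB u v - κA u v) * (Φ u v - m u)|))
              + ∑ u ∈ EU, ν u * ∑ v ∈ EV, (κA u v + κB u v) * (Φ u v - m u) ^ 2)
        / (∑ u ∈ EU, ν u * ∑ v ∈ EV, κB u v) := by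
  haveI := imageLaw_neZero (Φ := Φ) hν hκB hpos
  have hB : 0 ≤ B := (abs_nonneg _).trans (hWb 0)
  set FlatC := ∑ u ∈ EU, ν u * (|m u - x₀ u| * |∑ v ∈ EV, (κB u v - κA u v) * (Φ u v - m u)|) with hFlatC
  set M₂ := ∑ u ∈ EU, ν u * ∑ v ∈ EV, (κA u v + κB u v) * (Φ u v - m u) ^ 2 with hM₂
  set eB := Real.exp (|s| * B) with heB
  set F₂ := ((1 + |s| * B) * B₂ + |s| * (2 + |s| * B) * B₁ ^ 2) * eB with hF₂
  set G₂ := (|s| * B₂ + s ^ 2 * B₁ ^ 2) * eB with hG₂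
  -- the two test integrals, by the sibling's critical swap with §1's criticality and Lipschitz constants
  have hD₁ : |(∫ x, W x * Real.exp (s * W x) ∂(imageLaw EU EV ν κB Φ))
      - ∫ x, W x * Real.exp (s * W x) ∂(imageLaw EU EV ν κA Φ)| ≤ F₂ * FlatC + F₂ * M₂ := by
    rw [integral_imageLaw_sub (fun x => W x * Real.exp (s * W x)) hν hκA hκB]
    exact abs_fibred_swap_le_of_critical (Φ := Φ) (m := m) (x₀ := x₀) (g := fun x => W x * Real.exp (s * W x))
      (g' := fun x => (1 + s * W x) * W' x * Real.exp (s * W x)) hν hκA hκB hmass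
      (taylor_two_mulExpTilt hW hW' hWb hW'b hW''b s) (abs_mulExpTilt_deriv_sub_le hW hW' hWb hW'b hW''b s)
      (fun u hu => mulExpTilt_deriv_eq_zero (hcrit u hu) s)
  have hD₀ : |(∫ x, Real.exp (s * W x) ∂(imageLaw EU EV ν κB Φ))
      - ∫ x, Real.exp (s * W x) ∂(imageLaw EU EV ν κA Φ)| ≤ G₂ * FlatC + G₂ * M₂ := by
    rw [integral_imageLaw_sub (fun x => Real.exp (s * W x)) hν hκA hκB]
    exact abs_fibred_swap_le_of_critical (Φ := Φ) (m := m) (x₀ := x₀) (g := fun x => Real.exp (s * W x))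
      (g' := fun x => s * W' x * Real.exp (s * W x)) hν hκA hκB hmass
      (taylor_two_expTilt hW hW' hWb hW'b hW''b s) (abs_expTilt_deriv_sub_le hW hW' hWb hW'b hW''b s)
      (fun u hu => expTilt_deriv_eq_zero (hcrit u hu) s)
  -- the parent inequality (gen 6 §1)
  have hpar := abs_tiltedMean_sub_le_of_tests (π := imageLaw EU EV ν κA Φ) (π' := imageLaw EU EV ν κB Φ) hWm hWb s hD₁ hD₀
  -- the denominator: `∫ e^{sW} d(on) ≥ e^{−|s|B}·mass`
  set mass := ∑ u ∈ EU, ν u * ∑ v ∈ EV, κB u v with hmassB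
  set eB' := Real.exp (-(|s| * B)) with heB'
  have hZ : eB' * mass ≤ ∫ x, Real.exp (s * W x) ∂(imageLaw EU EV ν κB Φ) := by
    rw [integral_imageLaw (fun x => Real.exp (s * W x)) hν hκB, hmassB, mul_sum]
    refine sum_le_sum fun u hu => ?_
    rw [mul_left_comm, mul_sum]
    refine mul_le_mul_of_nonneg_left (sum_le_sum fun v hv => ?_) (hν u hu)
    rw [mul_comm eB' (κB u v)]
    exact mul_le_mul_of_nonneg_left (exp_neg_abs_le_exp_mul hWb s (Φ u v)) (hκB u hu v hv)
  have hmass0 : 0 < mass := hpos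
  have hZpos : 0 < eB' * mass := mul_pos (Real.exp_pos _) hmass0
  have hnum0 : 0 ≤ F₂ * FlatC + F₂ * M₂ + B * (G₂ * FlatC + G₂ * M₂) :=
    add_nonneg ((abs_nonneg _).trans hD₁) (mul_nonneg hB ((abs_nonneg _).trans hD₀))
  have he : Real.exp (2 * (|s| * B)) * eB' = eB := by
    rw [heB, heB', ← Real.exp_add]; congr 1; ring
  calc |tiltedMean W (imageLaw EU EV ν κB Φ) s - tiltedMean W (imageLaw EU EV ν κA Φ) s|
      ≤ (F₂ * FlatC + F₂ * M₂ + B * (G₂ * FlatC + G₂ * M₂)) / (eB' * mass) :=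
        hpar.trans (div_le_div_of_nonneg_left hnum0 hZpos hZ)
    _ = Real.exp (2 * (|s| * B)) * ((1 + |s| * B) * B₂ + |s| * (2 + |s| * B) * B₁ ^ 2 + B * (|s| * B₂ + s ^ 2 * B₁ ^ 2))
          * (FlatC + M₂) / mass := by
        rw [div_eq_div_iff (ne_of_gt hZpos) (ne_of_gt hmass0), hF₂, hG₂, ← he]
        ring

/-- **… WITH THE DISPLACEMENT SPLIT: first order in the CURVATURE × exterior flatness + second order.**  If the displacement is
`Φ u v − m u = θ·ℓ v + r u v` with `|r u v| ≤ θ₂·q v` (gradient `θ` and curvature `θ₂` of the composed averaging — both `≍ θ₁^{K−j}`)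
and the fibres are centred in the LINEAR image (`Σ_v κA ℓ = Σ_v κB ℓ`: gen 6's hypothesis), then with `Q_u = Σ_v (κA + κB) q v`:
`|Δ tiltedMean| ≤ e^{2|s|B}·C₂(s)·(θ₂·Σ_u ν_u |m u − x₀ u|·Q_u + M₂) ∕ mass(on)`.  Gen 6's `abs_tiltedMean_fibred_sub_le_of_centred`
is the case `r = 0`; for `r ≠ 0` the curvature term is removed by NOTHING but the exterior's flatness (through criticality) or a matched
`q`-moment (sibling §4: attained otherwise). [folklore] -/
theorem abs_tiltedMean_image_sub_le_of_centred_of_critical {r : U → V → ℝ} {ℓ q : V → ℝ} {θ θ₂ : ℝ}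
    (hν : ∀ u ∈ EU, 0 ≤ ν u) (hκA : ∀ u ∈ EU, ∀ v ∈ EV, 0 ≤ κA u v)
    (hκB : ∀ u ∈ EU, ∀ v ∈ EV, 0 ≤ κB u v) (hmass : ∀ u ∈ EU, ∑ v ∈ EV, κA u v = ∑ v ∈ EV, κB u v)
    (hmean : ∀ u ∈ EU, ∑ v ∈ EV, κA u v * ℓ v = ∑ v ∈ EV, κB u v * ℓ v)
    (hΦ : ∀ u ∈ EU, ∀ v ∈ EV, Φ u v - m u = θ * ℓ v + r u v) (hr : ∀ u ∈ EU, ∀ v ∈ EV, |r u v| ≤ θ₂ * q v)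
    (hpos : 0 < ∑ u ∈ EU, ν u * ∑ v ∈ EV, κB u v)
    (hWm : Measurable W) (hW : ∀ y, HasDerivAt W (W' y) y) (hW' : ∀ y, HasDerivAt W' (W'' y) y)
    (hWb : ∀ y, |W y| ≤ B) (hW'b : ∀ y, |W' y| ≤ B₁) (hW''b : ∀ y, |W'' y| ≤ B₂) (hcrit : ∀ u ∈ EU, W' (x₀ u) = 0) (s : ℝ) :
    |tiltedMean W (imageLaw EU EV ν κB Φ) s - tiltedMean W (imageLaw EU EV ν κA Φ) s|
      ≤ Real.exp (2 * (|s| * B)) * ((1 + |s| * B) * B₂ + |s| * (2 + |s| * B) * B₁ ^ 2 + B * (|s| * B₂ + s ^ 2 * B₁ ^ 2))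
          * (θ₂ * (∑ u ∈ EU, ν u * (|m u - x₀ u| * ∑ v ∈ EV, (κA u v + κB u v) * q v))
              + ∑ u ∈ EU, ν u * ∑ v ∈ EV, (κA u v + κB u v) * (Φ u v - m u) ^ 2)
        / (∑ u ∈ EU, ν u * ∑ v ∈ EV, κB u v) := by
  have hB : 0 ≤ B := (abs_nonneg _).trans (hWb 0)
  have hB₁ : 0 ≤ B₁ := (abs_nonneg _).trans (hW'b 0)
  have hB₂ : 0 ≤ B₂ := (abs_nonneg _).trans (hW''b 0)
  refine (abs_tiltedMean_image_sub_le_of_critical (Φ := Φ) (m := m) (x₀ := x₀) hν hκA hκB hmass hpos hWm hW hW' hWb hW'b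
    hW''b hcrit s).trans ?_
  have hC : 0 ≤ Real.exp (2 * (|s| * B))
      * ((1 + |s| * B) * B₂ + |s| * (2 + |s| * B) * B₁ ^ 2 + B * (|s| * B₂ + s ^ 2 * B₁ ^ 2)) := by positivity
  refine div_le_div_of_nonneg_right (mul_le_mul_of_nonneg_left (add_le_add ?_ le_rfl) hC) hpos.le
  rw [mul_sum]
  refine sum_le_sum fun u hu => ?_
  have hcen : ∑ v ∈ EV, (κB u v - κA u v) * ℓ v = 0 := by
    simp only [sub_mul, sum_sub_distrib, hmean u hu, sub_self]
  have h := abs_flat_displacement_le (Φ := Φ) (m := m) hκA hκB hΦ hr hu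
  rw [hcen, abs_zero, mul_zero, zero_add] at h
  calc ν u * (|m u - x₀ u| * |∑ v ∈ EV, (κB u v - κA u v) * (Φ u v - m u)|)
      ≤ ν u * (|m u - x₀ u| * (θ₂ * ∑ v ∈ EV, (κA u v + κB u v) * q v)) :=
        mul_le_mul_of_nonneg_left (mul_le_mul_of_nonneg_left h (abs_nonneg _)) (hν u hu)
    _ = θ₂ * (ν u * (|m u - x₀ u| * ∑ v ∈ EV, (κA u v + κB u v) * q v)) := by ring

end Influence

/-! ## §4 The ledger with two profiles: the first-order channel's letter `θ₁φΛ` next to the second order's `θ₁²Λ` -/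

section Ledger

variable {ι D : Type*} [DecidableEq ι] {l₀ vol : ℝ} {T : ℕ → Finset ι} {Bad : ℕ → ℝ → Finset ι}
  {wf : ℕ → ι → Finset D} {sc : ℕ → D → ℕ} {Δ : ℕ → ℝ → ι → ℝ → D → ℝ}

/-- **FLATNESS PROFILE + SECOND ORDER ⇒ `OldInfluenceBudget` WITH RATIO `max(θ₁φΛ, θ₁²Λ)`.**  If on every good class and every tilt
`|s| ≤ l₀` each slot's influence is at most `Cv·(θ₁^{K − sc X}·F X + θ₁^{2(K − sc X)}·M X)` (§3: first order = transfer rate × the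
product of the two flatness factors, collected in `F X`; second order × `M X`), the flatness profile decays with the slot's age,
`F X ≤ σF·φ^{K − sc X}` ([B12] (1.11)∕(1.14), [B14] (2.34) KIND: backgrounds in the scale-`j` inductive domains are flat to `φ^{K−j}` —
NE1.md R28 (β2), a READING and the hypothesis here), `M X ≤ σM`, and there are at most `vol·Λ^{K−j}` scale-`j` slots, then for every
`r` dominating both letters (`θ₁φΛ ≤ r`, `θ₁²Λ ≤ r`): `OldInfluenceBudget l₀ T Bad wf sc Δ vol (Cv·(σF + σM)) r`.  In `d = 4` the
letters are `L⁻¹` and `L⁻²` (below), so `r = L⁻¹`: R28 (2)'s «a = L⁴θ₁φ = L⁻¹ < 1» as a theorem of the ledger.  (`L⁻¹` is what this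
currency certifies WITHOUT decoupling — absolute values fibrewise, R28 (2)'s sup count; R28 (3)'s integrated count reaches `L⁻²` for the
same channel by the decoupling of its two mean-zero factors across exteriors, an input this currency forgoes; either is `< 1`.) [folklore] -/
theorem oldInfluenceBudget_of_flatness_profile {F M : ℕ → ι → D → ℝ} {Cv σF σM θ₁ φ Λ r : ℝ} (hCv : 0 ≤ Cv)
    (hθ₁ : 0 ≤ θ₁) (hφ : 0 ≤ φ) (hΛ : 0 ≤ Λ) (hσF : 0 ≤ σF) (hσM : 0 ≤ σM) (hr₁ : θ₁ * φ * Λ ≤ r) (hr₂ : θ₁ ^ 2 * Λ ≤ r)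
    (hΔ : ∀ K (t : ℝ), |t| ≤ l₀ → ∀ τ ∈ T K \ Bad K t, ∀ s : ℝ, |s| ≤ l₀ → ∀ X ∈ wf K τ,
      |Δ K t τ s X| ≤ Cv * (θ₁ ^ (K - sc K X) * F K τ X + θ₁ ^ (2 * (K - sc K X)) * M K τ X))
    (hF : ∀ K (τ : ι), ∀ X ∈ wf K τ, F K τ X ≤ σF * φ ^ (K - sc K X)) (hM : ∀ K (τ : ι), ∀ X ∈ wf K τ, M K τ X ≤ σM)
    (hcount : ∀ K (τ : ι), ∀ j ≤ K, (((wf K τ).filter fun X => sc K X = j).card : ℝ) ≤ vol * Λ ^ (K - j)) :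
    OldInfluenceBudget l₀ T Bad wf sc Δ vol (Cv * (σF + σM)) r := by
  refine oldInfluenceBudget_of_visibility
    (vis := fun K τ X => θ₁ ^ (K - sc K X) * F K τ X + θ₁ ^ (2 * (K - sc K X)) * M K τ X) hCv hΔ ?_
  intro K τ j hj
  have hvol : 0 ≤ vol := by
    have h := hcount K τ K le_rfl
    rw [Nat.sub_self, pow_zero, mul_one] at h
    exact (Nat.cast_nonneg _).trans h
  have ha₁ : 0 ≤ θ₁ * φ * Λ := mul_nonneg (mul_nonneg hθ₁ hφ) hΛ
  have ha₂ : 0 ≤ θ₁ ^ 2 * Λ := mul_nonneg (sq_nonneg _) hΛ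
  have hc : 0 ≤ θ₁ ^ (K - j) * (σF * φ ^ (K - j)) + θ₁ ^ (2 * (K - j)) * σM :=
    add_nonneg (mul_nonneg (pow_nonneg hθ₁ _) (mul_nonneg hσF (pow_nonneg hφ _))) (mul_nonneg (pow_nonneg hθ₁ _) hσM)
  calc ∑ X ∈ wf K τ with sc K X = j, (θ₁ ^ (K - sc K X) * F K τ X + θ₁ ^ (2 * (K - sc K X)) * M K τ X)
      ≤ ∑ X ∈ wf K τ with sc K X = j, (θ₁ ^ (K - j) * (σF * φ ^ (K - j)) + θ₁ ^ (2 * (K - j)) * σM) := by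
        refine sum_le_sum fun X hX => ?_
        obtain ⟨hXw, hXj⟩ := mem_filter.mp hX
        have h1 := hF K τ X hXw
        have h2 := hM K τ X hXw
        rw [hXj] at h1 ⊢
        exact add_le_add (mul_le_mul_of_nonneg_left h1 (pow_nonneg hθ₁ _)) (mul_le_mul_of_nonneg_left h2 (pow_nonneg hθ₁ _))
    _ = (((wf K τ).filter fun X => sc K X = j).card : ℝ) * (θ₁ ^ (K - j) * (σF * φ ^ (K - j)) + θ₁ ^ (2 * (K - j)) * σM) := by
        rw [sum_const, nsmul_eq_mul]
    _ ≤ (vol * Λ ^ (K - j)) * (θ₁ ^ (K - j) * (σF * φ ^ (K - j)) + θ₁ ^ (2 * (K - j)) * σM) :=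
        mul_le_mul_of_nonneg_right (hcount K τ j hj) hc
    _ = vol * (σF * (θ₁ * φ * Λ) ^ (K - j) + σM * (θ₁ ^ 2 * Λ) ^ (K - j)) := by
        rw [mul_pow, mul_pow, mul_pow, ← pow_mul]; ring
    _ ≤ vol * (σF * r ^ (K - j) + σM * r ^ (K - j)) := by
        refine mul_le_mul_of_nonneg_left (add_le_add ?_ ?_) hvol
        · exact mul_le_mul_of_nonneg_left (pow_le_pow_left₀ ha₁ hr₁ _) hσF
        · exact mul_le_mul_of_nonneg_left (pow_le_pow_left₀ ha₂ hr₂ _) hσM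
    _ = vol * ((σF + σM) * r ^ (K - j)) := by ring

/-- [bookkeeping] The first-order channel's letter in `d = 4`: `θ₁·φ·Λ = L⁻³·L⁻²·L⁴ = L⁻¹` (`L ≠ 0`). [folklore] -/
theorem flatFirstOrder_rate_eq {L : ℝ} (hL : L ≠ 0) : L⁻¹ ^ 3 * L⁻¹ ^ 2 * L ^ 4 = L⁻¹ := by
  field_simp

/-- [bookkeeping] … so it is `< 1` for `L > 1` — by ne7's located criterion `firstOrder_rate_lt_one_iff` («`a < 1` iff the flatness factor
beats the block size, `φ < L⁻¹`») with `φ = L⁻²`: the flatness of the backgrounds IS good enough; next to the second order's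
`θ₁²Λ = L⁻² < 1` (`Spine.NE7.rate_secondOrder_lt_one`).  The budget's letter is the larger one, `L⁻¹`. [folklore] -/
theorem flatFirstOrder_rate_lt_one {L : ℝ} (hL : 1 < L) : L⁻¹ ^ 3 * L⁻¹ ^ 2 * L ^ 4 < 1 := by
  have hL0 : 0 < L := zero_lt_one.trans hL
  have hinv : L⁻¹ < 1 := inv_lt_one_of_one_lt₀ hL
  have hinv0 : 0 < L⁻¹ := inv_pos.mpr hL0
  refine (Spine.NE7.firstOrder_rate_lt_one_iff hL0).mpr ?_
  calc L⁻¹ ^ 2 = L⁻¹ * L⁻¹ := sq _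
    _ < L⁻¹ * 1 := mul_lt_mul_of_pos_left hinv hinv0
    _ = L⁻¹ := mul_one _

/-- [bookkeeping] In `d = 4` the second-order letter is dominated by the first-order one: `θ₁²Λ = L⁻² ≤ L⁻¹ = θ₁φΛ` (`L ≥ 1`), so
`r = L⁻¹` serves `oldInfluenceBudget_of_flatness_profile`. [folklore] -/
theorem secondOrder_rate_le_flatFirstOrder {L : ℝ} (hL : 1 ≤ L) : (L⁻¹ ^ 3) ^ 2 * L ^ 4 ≤ L⁻¹ ^ 3 * L⁻¹ ^ 2 * L ^ 4 := by
  have hL0 : 0 < L := zero_lt_one.trans_le hL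
  rw [flatFirstOrder_rate_eq hL0.ne', Spine.NE7.rate_secondOrder_eq hL0.ne']
  calc L⁻¹ ^ 2 = L⁻¹ * L⁻¹ := sq _
    _ ≤ L⁻¹ * 1 := mul_le_mul_of_nonneg_left (inv_le_one_of_one_le₀ hL) (inv_nonneg.mpr hL0.le)
    _ = L⁻¹ := mul_one _

end Ledger

end Summit.QuantumFields.BalabanUV.T4Continuum.NE1p.TiltedMeanSmoothDualCriticalTilt

end
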